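import Mathlib
import HarnessLib
import Literature.Analysis.Convex.ConvexMetricProjection
import Literature.Analysis.Convex.KrasnoselskijIteration
import Literature.Analysis.Convex.AveragedOperators
import Literature.Analysis.Convex.DouglasRachfordSplitting

/-!
# The minimal (infimal) displacement vector of a nonexpansive map: Pazy 1971 and
# Baillon–Bruck–Reich 1978

Literature anchor (statements follow the sources; the proofs are the elementary Hilbert-space
proofs indicated below; nothing here is new mathematics):

* [Paz71] A. Pazy, *Asymptotic behavior of contractions in Hilbert space*, Israel J. Math. **9**
  (1971) 235–240, doi:10.1007/bf02771588 (bib: Pazy1971). The primary text is not held by `lit`;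
  the statements formalised are the ones reproduced — and attributed to [Paz71] — in
  [BM16, Fact 2.2], [LRY19, §2.2] and [Ban21, Fact 2.1]: for a nonexpansive `T : H → H` on a real
  Hilbert space, **`cl ran(I − T)` is convex**; consequently the *infimal (minimal) displacement
  vector* `v := P_{cl ran(I − T)}(0)` is the unique element of `cl ran(I − T)` of least norm,
  `‖v‖ = inf_x ‖x − T x‖`; and **`Tⁿx / n → −v`** (equivalently `(x − Tⁿx)/n → v`), so that
  `‖Tⁿx‖ → ∞` for every `x` as soon as `v ≠ 0` ([BM16, proof of Thm 4.2]: "Using [Pazy] we learn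
  that for every `x ∈ X` we have `‖Tⁿx‖ → ∞`"; [BHM14, (28)]: `v = −lim Tⁿx/n = lim Tⁿx − Tⁿ⁺¹x`).
* [BBR78] J.-B. Baillon, R. E. Bruck, S. Reich, *On the asymptotic behavior of nonexpansive
  mappings and semigroups in Banach spaces*, Houston J. Math. **4** (1978) 1–9 (bib:
  BaillonBruckReich1978; not held; statement as reproduced in [LRY19, Lemma 1] = "Corollary 2.3 of
  [BBR78]" and in [Ban21, Fact 2.1]): for `T` **averaged** (in particular firmly nonexpansive),
  **`Tⁿx − Tⁿ⁺¹x → v`** for every starting point `x`.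
* [LRY19] Y. Liu, E. K. Ryu, W. Yin, *A new use of Douglas–Rachford splitting for identifying
  infeasible, unbounded, and pathological conic programs*, Math. Program. **177** (2019) 225–253,
  doi:10.1007/s10107-018-1265-5 = arXiv:1706.02374 (bib: LiuRyuYin2018; held, `lit` key
  `paper:arxiv-1706.02374`, §2.2): **Lemma 1** (`zᵏ − zᵏ⁺¹ → v = P_{cl ran(I−T)}(0)` for the
  fixed-point iteration of a firmly nonexpansive `T`) and **Theorem 3** with its proof — the proof
  formalised below for [BBR78, Cor 2.3] IS theirs ("we provide a simpler proof in our setting"):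
  approximate `v` by a displacement `y − T y`, observe that the whole orbit of `y` then has
  displacements uniformly close to `v` (their (eq:sequence), via `‖v‖² ≤ ⟨y', v⟩` on
  `cl ran(I − T)`), and compare the orbits of `x` and `y` through the summable inequality
  `Σⱼ ‖(I−T)Tʲx − (I−T)Tʲy‖² ≤ ‖x − y‖²`; including the approximate rate
  `min_{j ≤ k} ‖zʲ − zʲ⁺¹ − v‖ ≤ M_ε/√(k+1) + ε` and `‖v‖ ≤ ‖zʲ − zʲ⁺¹‖`.
* [BM16] H. H. Bauschke, W. M. Moursi, *The Douglas–Rachford algorithm for two (not necessarily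
  intersecting) affine subspaces*, SIAM J. Optim. **26** (2016) 968–985, doi:10.1137/15m1016989 =
  arXiv:1504.03721 (bib: BauschkeMoursi2016; held, `paper:arxiv-1504.03721`): **Fact 2.2**
  (infimal displacement vector: `cl ran(Id − T)` convex, `v` the unique element with
  `‖v‖ = inf ‖x − Tx‖`) and **Lemma 2.3** (an element `c ∈ C` with `‖c‖ = ‖P_C 0‖` is `P_C 0`).
* [Ban21] G. Banjac, *On the minimal displacement vector of the Douglas–Rachford operator*,
  Oper. Res. Lett. **49** (2021) 197–200, doi:10.1016/j.orl.2021.01.003 = arXiv:2009.01201 (bib: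
  Banjac2021; held, `paper:arxiv-2009.01201`): **Fact 2.1** (for an averaged `T` and
  `sⁿ⁺¹ = T sⁿ`: `sⁿ − sⁿ⁺¹ → v`, with `cl ran(Id − T)` nonempty closed convex [Paz71]) — the
  fixed-point fact behind infeasibility detection in Douglas–Rachford / ADMM solvers.

## What is formalised

`H` is a real inner product space (complete where stated); `T : H → H` is nonexpansive,
`‖T x − T y‖ ≤ ‖x − y‖`. `dispRange T = ran(I − T) = {x − T x}`.

* `I − T` is monotone (`inner_sub_sub_nonneg`) and, for `ε > 0`, `(1 + ε) x − T x = c` is solvable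
  (`exists_resolvent`, Banach's fixed point theorem for the strict contraction
  `x ↦ (1 + ε)⁻¹(T x + c)`; this is the resolvent `(εI + A)⁻¹`, `A = I − T`, of [Paz71]).
* **[Paz71] convexity**: `convex_closure_dispRange`. Proof (the standard monotone-operator
  argument): for `u = t u₁ + (1 − t) u₂` with `uᵢ = xᵢ − T xᵢ` and `w = t x₁ + (1 − t) x₂`, the
  solution `x_ε` of `A x_ε + ε(x_ε − w) = u` satisfies, by monotonicity of `A`,
  `ε‖x_ε − w‖² ≤ t(1 − t)⟨u₂ − u₁, x₂ − x₁⟩`, so `A x_ε → u` as `ε → 0`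
  (`segment_mem_closure_dispRange`); a closed set containing all such segments is convex.
* The vector `minDisp T := proj (closure (dispRange T)) 0` (the tree's metric projection
  `ConvexMetricProjection.proj`): membership, minimality `‖v‖ ≤ ‖x − T x‖`, the variational
  inequality `‖v‖² ≤ ⟨y, v⟩` and its consequence `‖y − v‖² ≤ ‖y‖² − ‖v‖²` on `cl ran(I − T)`,
  uniqueness ([BM16, Lemma 2.3]: `eq_minDisp`), `‖v‖ = ⨅ x, ‖x − T x‖`
  (`norm_minDisp_eq_iInf`), `v = 0` iff `inf ‖x − Tx‖ = 0`, `v = 0` if `T` has a fixed point,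
  no fixed point if `v ≠ 0`.
* **[Paz71] mean ergodic displacement**: `(x − Tⁿx)/n ∈ cl ran(I − T)` (an average of
  displacements), `‖v‖ ≤ ‖(x − Tⁿx)/n‖ ≤ 2‖x − y‖/n + ‖y − Ty‖`, hence `‖(x − Tⁿx)/n‖ → ‖v‖`
  (`tendsto_norm_avg`) and, by `‖a − v‖² ≤ ‖a‖² − ‖v‖²`, `(x − Tⁿx)/n → v` (`tendsto_avg`),
  `Tⁿx/n → −v` (`tendsto_inv_smul_iterate`), `‖Tⁿx‖/n → ‖v‖`, and `‖Tⁿx‖ → ∞` when `v ≠ 0`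
  (`tendsto_norm_iterate_atTop`).
* **[BBR78, Cor 2.3] / [LRY19, Thm 3]** for maps satisfying the `ν`-inequality
  `‖T x − T y‖² + ν‖(x − T x) − (y − T y)‖² ≤ ‖x − y‖²` with `ν > 0` (firmly nonexpansive:
  `ν = 1`; `α`-averaged with `0 < α < 1`: `ν = (1 − α)/α`, the tree's
  `IsAveraged.norm_sq_add_le`): `Tⁿx − Tⁿ⁺¹x → v` (`tendsto_disp_of_sq`,
  `tendsto_disp_of_firmlyNonexpansive`, `tendsto_disp_of_isAveraged`), `‖Tⁿx − Tⁿ⁺¹x‖ ↓ ‖v‖`,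
  and the [LRY19, Thm 3] rate `∃ M ≥ 0, ∀ k, ∃ j ≤ k, ‖Tʲx − Tʲ⁺¹x − v‖ ≤ M/√(k+1) + ε`.
* Dictionary to the tree's iterations: for the Krasnosel'skiĭ–Mann iteration
  `kmIter R λ x` of a nonexpansive `R` (`KrasnoselskijIteration`), `minDisp` of the averaged map is
  `λ • minDisp R`, `x_n − x_{n+1} → λ v_R` for `λ ∈ ]0,1[` ([Ban21, Fact 2.1]),
  `(x₀ − x_n)/n → λ v_R` and `‖x_n‖ → ∞` if `v_R ≠ 0` for `λ ∈ ]0,1]` ([Paz71]); for the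
  Douglas–Rachford iteration `drIter` of `DouglasRachfordSplitting` (resolvent maps of two
  monotone operators), `zⁿ − zⁿ⁺¹ → minDisp (drStep ja jb)` ([LRY19, Lemma 1]).

Not transcribed: the Banach-space generality and the strongly-nonexpansive class of [BBR78];
[Paz71]'s results for general maximal monotone `A` (only `A = I − T` is treated); the
identification of `v` for specific splittings ([BM16, §3], [Ban21, Thm 3.1], [LRY19, §2.3 ff]).
Everything is proved; there are no named facts and no `sorry`.
-/

open Filter Topology Finset
open scoped RealInnerProductSpace

namespace Literature.Analysis.Convex.MinimalDisplacement

open Literature.Analysis.Convex.ConvexMetricProjection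
open Literature.Analysis.Convex.KrasnoselskijIteration
open Literature.Analysis.Convex.AveragedOperators
open Literature.Analysis.Convex.MonotoneOperator
open Literature.Analysis.Convex.DouglasRachford

variable {H : Type*} [NormedAddCommGroup H]
variable {T : H → H} {x y : H} {ν ε : ℝ} {n : ℕ}

/-! ## The displacement set `ran(I − T)` and the monotone operator `A = I − T` -/

/-- The displacement set `ran(I − T) = {x − T x : x ∈ H}`. [cite: Pazy1971, Introduction] -/
def dispRange (T : H → H) : Set H := Set.range fun x => x - T x

/-- `x − T x ∈ ran(I − T)`. [cite: Pazy1971, Introduction] -/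
theorem sub_mem_dispRange (T : H → H) (x : H) : x - T x ∈ dispRange T := ⟨x, rfl⟩

/-- `Tⁿx − Tⁿ⁺¹x = (I − T)(Tⁿx) ∈ ran(I − T)`. [cite: Pazy1971, Introduction] -/
theorem iterate_sub_iterate_succ_mem_dispRange (T : H → H) (x : H) (n : ℕ) :
    T^[n] x - T^[n + 1] x ∈ dispRange T :=
  ⟨T^[n] x, by simp only [Function.iterate_succ_apply']⟩

/-- `ran(I − T)` is nonempty. [cite: Pazy1971, Introduction] -/
theorem dispRange_nonempty (T : H → H) : (dispRange T).Nonempty := ⟨_, sub_mem_dispRange T 0⟩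

/-- `cl ran(I − T)` is nonempty. [cite: Pazy1971, Introduction] -/
theorem closure_dispRange_nonempty (T : H → H) : (closure (dispRange T)).Nonempty :=
  (dispRange_nonempty T).closure

/-- `cl ran(I − T)` is complete (in a Hilbert space). [cite: Pazy1971, Introduction] -/
theorem isComplete_closure_dispRange [CompleteSpace H] (T : H → H) :
    IsComplete (closure (dispRange T)) :=
  isClosed_closure.isComplete

section Basic

variable [InnerProductSpace ℝ H]

/-- `A = I − T` is monotone for `T` nonexpansive: `⟨(x − Tx) − (y − Ty), x − y⟩ ≥ 0`.
[cite: Pazy1971, Introduction] -/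
theorem inner_sub_sub_nonneg (hT : ∀ x y, ‖T x - T y‖ ≤ ‖x - y‖) (x y : H) :
    0 ≤ ⟪(x - T x) - (y - T y), x - y⟫ := by
  have e : ⟪(x - T x) - (y - T y), x - y⟫ = ‖x - y‖ ^ 2 - ⟪T x - T y, x - y⟫ := by
    have h1 : (x - T x) - (y - T y) = (x - y) - (T x - T y) := by abel
    rw [h1, inner_sub_left, real_inner_self_eq_norm_sq]
  rw [e]
  have h1 : ⟪T x - T y, x - y⟫ ≤ ‖T x - T y‖ * ‖x - y‖ := real_inner_le_norm _ _
  have h2 := hT x y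
  nlinarith [norm_nonneg (x - y), norm_nonneg (T x - T y)]

/-- The resolvent equation of `A = I − T`: for `ε > 0` and every `c`, `(1 + ε) x − T x = c` has a
solution (Banach's fixed point theorem applied to the strict contraction `x ↦ (1 + ε)⁻¹(T x + c)`).
[cite: Pazy1971, Introduction] -/
theorem exists_resolvent [CompleteSpace H] (hT : ∀ x y, ‖T x - T y‖ ≤ ‖x - y‖) (hε : 0 < ε)
    (c : H) : ∃ x : H, (1 + ε) • x - T x = c := by
  have h1ε : (0 : ℝ) < 1 + ε := by linarith
  let K : NNReal := ⟨(1 + ε)⁻¹, by positivity⟩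
  have hK : (K : ℝ) = (1 + ε)⁻¹ := rfl
  have hK1 : K < 1 := by
    rw [← NNReal.coe_lt_coe, hK, NNReal.coe_one]
    exact inv_lt_one_of_one_lt₀ (by linarith)
  have hΦ : ContractingWith K (fun x => (1 + ε)⁻¹ • (T x + c)) := by
    refine ⟨hK1, LipschitzWith.of_dist_le_mul fun x y => ?_⟩
    rw [dist_eq_norm, dist_eq_norm, hK, ← smul_sub, add_sub_add_right_eq_sub, norm_smul,
      Real.norm_eq_abs, abs_of_pos (by positivity)]
    exact mul_le_mul_of_nonneg_left (hT x y) (by positivity)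
  haveI : Nonempty H := ⟨c⟩
  set p := ContractingWith.fixedPoint _ hΦ with hp
  have hfix : (1 + ε)⁻¹ • (T p + c) = p := hΦ.fixedPoint_isFixedPt
  refine ⟨p, ?_⟩
  have h2 : (1 + ε) • p = T p + c := by
    rw [← hfix, smul_smul, mul_inv_cancel₀ h1ε.ne', one_smul]
    -- `T ((1 + ε)⁻¹ • (T p + c)) = T p` by `hfix`
    rw [hfix]
  rw [h2]
  abel

/-! ## [Paz71]: `cl ran(I − T)` is convex -/

/-- The heart of the convexity proof: every convex combination of two displacements
`t(x₁ − Tx₁) + (1 − t)(x₂ − Tx₂)` lies in `cl ran(I − T)`. With `u`, `w` the convex combinations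
of the `uᵢ = xᵢ − Txᵢ` and of the `xᵢ`, the solution `x_ε` of `(I − T)x_ε + ε(x_ε − w) = u`
satisfies `ε‖x_ε − w‖² ≤ t(1 − t)⟨u₂ − u₁, x₂ − x₁⟩` by monotonicity, so
`‖(I − T)x_ε − u‖² ≤ ε · t(1 − t)⟨u₂ − u₁, x₂ − x₁⟩ → 0`. [cite: Pazy1971, Introduction] -/
theorem segment_mem_closure_dispRange [CompleteSpace H] (hT : ∀ x y, ‖T x - T y‖ ≤ ‖x - y‖)
    (x₁ x₂ : H) {t : ℝ} (ht0 : 0 ≤ t) (ht1 : t ≤ 1) :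
    t • (x₁ - T x₁) + (1 - t) • (x₂ - T x₂) ∈ closure (dispRange T) := by
  set u₁ := x₁ - T x₁ with hu₁
  set u₂ := x₂ - T x₂ with hu₂
  set u := t • u₁ + (1 - t) • u₂ with hu
  set w := t • x₁ + (1 - t) • x₂ with hw
  set c := t * (1 - t) * ⟪u₂ - u₁, x₂ - x₁⟫ with hc
  rw [Metric.mem_closure_iff]
  intro δ hδ
  set ε := δ ^ 2 / (|c| + 1) with hεdef
  have hε : 0 < ε := by positivity
  obtain ⟨z, hz⟩ := exists_resolvent hT hε (u + ε • w)
  have hv : z - T z - u = -(ε • (z - w)) := by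
    have h1 : z - T z = u + ε • w - ε • z := by
      rw [← hz, add_smul, one_smul]
      abel
    rw [h1, smul_sub]
    abel
  have m1 : 0 ≤ ⟪(z - T z) - u₁, z - x₁⟫ := by rw [hu₁]; exact inner_sub_sub_nonneg hT z x₁
  have m2 : 0 ≤ ⟪(z - T z) - u₂, z - x₂⟫ := by rw [hu₂]; exact inner_sub_sub_nonneg hT z x₂
  have key : t * ⟪(z - T z) - u₁, z - x₁⟫ + (1 - t) * ⟪(z - T z) - u₂, z - x₂⟫
      = ⟪z - T z - u, z - w⟫ + c := by
    simp only [hu, hw, hc, inner_sub_left, inner_sub_right, inner_add_left, inner_add_right,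
      real_inner_smul_left, real_inner_smul_right]
    ring
  have hsum : 0 ≤ ⟪z - T z - u, z - w⟫ + c := by
    rw [← key]
    exact add_nonneg (mul_nonneg ht0 m1) (mul_nonneg (by linarith) m2)
  have hin : ⟪z - T z - u, z - w⟫ = -(ε * ‖z - w‖ ^ 2) := by
    rw [hv, inner_neg_left, real_inner_smul_left, real_inner_self_eq_norm_sq]
  have h1 : ε * ‖z - w‖ ^ 2 ≤ c := by linarith
  have h2 : ‖z - T z - u‖ ^ 2 ≤ ε * c := by
    rw [hv, norm_neg, norm_smul, Real.norm_eq_abs, abs_of_pos hε, mul_pow]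
    calc ε ^ 2 * ‖z - w‖ ^ 2 = ε * (ε * ‖z - w‖ ^ 2) := by ring
      _ ≤ ε * c := mul_le_mul_of_nonneg_left h1 hε.le
  have h3 : ε * c < δ ^ 2 := by
    have h4 : |c| / (|c| + 1) < 1 := by
      rw [div_lt_one (by positivity)]
      linarith
    calc ε * c ≤ ε * |c| := mul_le_mul_of_nonneg_left (le_abs_self c) hε.le
      _ = δ ^ 2 * (|c| / (|c| + 1)) := by rw [hεdef]; ring
      _ < δ ^ 2 * 1 := mul_lt_mul_of_pos_left h4 (by positivity)
      _ = δ ^ 2 := mul_one _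
  refine ⟨z - T z, sub_mem_dispRange T z, ?_⟩
  rw [dist_eq_norm, ← norm_neg, neg_sub]
  exact lt_of_pow_lt_pow_left₀ 2 hδ.le (by linarith)

/-- **[Paz71] (quoted as [BM16, Fact 2.2], [LRY19, §2.2], [Ban21, Fact 2.1]): for a nonexpansive
`T` on a real Hilbert space, `cl ran(I − T)` is convex.** [cite: Pazy1971, Introduction] -/
theorem convex_closure_dispRange [CompleteSpace H] (hT : ∀ x y, ‖T x - T y‖ ≤ ‖x - y‖) :
    Convex ℝ (closure (dispRange T)) := by
  intro a ha b hb p q hp hq hpq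
  rw [Metric.mem_closure_iff]
  intro δ hδ
  have hδ3 : 0 < δ / 3 := by positivity
  obtain ⟨a', ⟨x₁, hx₁⟩, hda⟩ := Metric.mem_closure_iff.1 ha (δ / 3) hδ3
  obtain ⟨b', ⟨x₂, hx₂⟩, hdb⟩ := Metric.mem_closure_iff.1 hb (δ / 3) hδ3
  simp only at hx₁ hx₂
  rw [← hx₁, dist_eq_norm] at hda
  rw [← hx₂, dist_eq_norm] at hdb
  have hq' : q = 1 - p := by linarith
  have hmem := segment_mem_closure_dispRange hT x₁ x₂ hp (by linarith)
  obtain ⟨c, hc, hdc⟩ := Metric.mem_closure_iff.1 hmem (δ / 3) hδ3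
  refine ⟨c, hc, ?_⟩
  have h1 : dist (p • a + q • b) (p • (x₁ - T x₁) + (1 - p) • (x₂ - T x₂)) ≤ δ / 3 := by
    rw [dist_eq_norm, ← hq']
    have e : p • a + q • b - (p • (x₁ - T x₁) + q • (x₂ - T x₂)) =
        p • (a - (x₁ - T x₁)) + q • (b - (x₂ - T x₂)) := by
      simp only [smul_sub]
      abel
    rw [e]
    have ha1 : ‖p • (a - (x₁ - T x₁))‖ ≤ p * (δ / 3) := by
      rw [norm_smul, Real.norm_eq_abs, abs_of_nonneg hp]
      exact mul_le_mul_of_nonneg_left hda.le hp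
    have hb1 : ‖q • (b - (x₂ - T x₂))‖ ≤ q * (δ / 3) := by
      rw [norm_smul, Real.norm_eq_abs, abs_of_nonneg hq]
      exact mul_le_mul_of_nonneg_left hdb.le hq
    calc ‖p • (a - (x₁ - T x₁)) + q • (b - (x₂ - T x₂))‖
        ≤ ‖p • (a - (x₁ - T x₁))‖ + ‖q • (b - (x₂ - T x₂))‖ := norm_add_le _ _
      _ ≤ p * (δ / 3) + q * (δ / 3) := add_le_add ha1 hb1
      _ = δ / 3 := by rw [← add_mul, hpq, one_mul]
  calc dist (p • a + q • b) c
      ≤ dist (p • a + q • b) (p • (x₁ - T x₁) + (1 - p) • (x₂ - T x₂)) +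
          dist (p • (x₁ - T x₁) + (1 - p) • (x₂ - T x₂)) c := dist_triangle _ _ _
    _ < δ / 3 + δ / 3 := add_lt_add_of_le_of_lt h1 hdc
    _ < δ := by linarith

/-! ## The minimal displacement vector `v = P_{cl ran(I−T)}(0)` -/

/-- The **minimal (infimal) displacement vector** `v := P_{cl ran(I − T)}(0)` of `T`
([BM16, Fact 2.2 (8)]; [LRY19, §2.2]; [Ban21, Fact 2.1]). [cite: Pazy1971, Introduction] -/
noncomputable def minDisp (T : H → H) : H := proj (closure (dispRange T)) 0

section Hilbert

variable [CompleteSpace H]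

/-- `v ∈ cl ran(I − T)`. [cite: BauschkeMoursi2016, Fact 2.2] -/
theorem minDisp_mem (hT : ∀ x y, ‖T x - T y‖ ≤ ‖x - y‖) : minDisp T ∈ closure (dispRange T) :=
  proj_mem (closure_dispRange_nonempty T) (isComplete_closure_dispRange T)
    (convex_closure_dispRange hT) 0

/-- `v` has least norm in `cl ran(I − T)`. [cite: BauschkeMoursi2016, Fact 2.2] -/
theorem norm_minDisp_le (hT : ∀ x y, ‖T x - T y‖ ≤ ‖x - y‖)
    (hy : y ∈ closure (dispRange T)) : ‖minDisp T‖ ≤ ‖y‖ := by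
  have h : ‖(0 : H) - minDisp T‖ ≤ ‖0 - y‖ :=
    norm_sub_proj_le (closure_dispRange_nonempty T) (isComplete_closure_dispRange T)
      (convex_closure_dispRange hT) 0 hy
  simpa using h

/-- `‖v‖ ≤ ‖x − T x‖` for every `x` ([BM16, Fact 2.2]; [LRY19, §2.2]).
[cite: BauschkeMoursi2016, Fact 2.2] -/
theorem norm_minDisp_le_norm_sub (hT : ∀ x y, ‖T x - T y‖ ≤ ‖x - y‖) (x : H) :
    ‖minDisp T‖ ≤ ‖x - T x‖ :=
  norm_minDisp_le hT (subset_closure (sub_mem_dispRange T x))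

/-- `‖v‖ ≤ ‖Tⁿx − Tⁿ⁺¹x‖`: the fixed-point residual of an orbit never drops below `‖v‖`
([LRY19, Thm 3], first inequality). [cite: LiuRyuYin2018, Thm 3] -/
theorem norm_minDisp_le_norm_disp (hT : ∀ x y, ‖T x - T y‖ ≤ ‖x - y‖) (x : H) (n : ℕ) :
    ‖minDisp T‖ ≤ ‖T^[n] x - T^[n + 1] x‖ :=
  norm_minDisp_le hT (subset_closure (iterate_sub_iterate_succ_mem_dispRange T x n))

/-- The variational inequality of the projection of `0`: `‖v‖² ≤ ⟨y, v⟩` for all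
`y ∈ cl ran(I − T)` ([LRY19, proof of Thm 3]: "`‖v‖² ≤ yᵀv` for any `y ∈ cl ran(I − T)`").
[cite: LiuRyuYin2018, Thm 3] -/
theorem norm_minDisp_sq_le_inner (hT : ∀ x y, ‖T x - T y‖ ≤ ‖x - y‖)
    (hy : y ∈ closure (dispRange T)) : ‖minDisp T‖ ^ 2 ≤ ⟪y, minDisp T⟫ := by
  have h : ⟪(0 : H) - minDisp T, y - minDisp T⟫ ≤ 0 :=
    inner_sub_proj_le_zero (closure_dispRange_nonempty T) (isComplete_closure_dispRange T)
      (convex_closure_dispRange hT) 0 hy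
  rw [zero_sub, inner_neg_left, inner_sub_right, real_inner_self_eq_norm_sq,
    real_inner_comm] at h
  linarith

/-- Consequence used throughout [LRY19, proof of Thm 3]: `‖y − v‖² ≤ ‖y‖² − ‖v‖²` for
`y ∈ cl ran(I − T)`. [cite: LiuRyuYin2018, Thm 3] -/
theorem norm_sub_minDisp_sq_le (hT : ∀ x y, ‖T x - T y‖ ≤ ‖x - y‖)
    (hy : y ∈ closure (dispRange T)) :
    ‖y - minDisp T‖ ^ 2 ≤ ‖y‖ ^ 2 - ‖minDisp T‖ ^ 2 := by
  have h := norm_minDisp_sq_le_inner hT hy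
  have e : ‖y - minDisp T‖ ^ 2 = ‖y‖ ^ 2 - 2 * ⟪y, minDisp T⟫ + ‖minDisp T‖ ^ 2 :=
    norm_sub_sq_real _ _
  rw [e]
  linarith

/-- **Uniqueness** ([BM16, Lemma 2.3 and Fact 2.2]: `v` is the unique element of `cl ran(I − T)`
with `‖v‖ ≤ ‖x − Tx‖` for all `x`). [cite: BauschkeMoursi2016, Lemma 2.3] -/
theorem eq_minDisp (hT : ∀ x y, ‖T x - T y‖ ≤ ‖x - y‖) (hy : y ∈ closure (dispRange T))
    (h : ∀ x, ‖y‖ ≤ ‖x - T x‖) : y = minDisp T := by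
  apply eq_proj_of_norm_sub_le (closure_dispRange_nonempty T) (isComplete_closure_dispRange T)
    (convex_closure_dispRange hT) hy
  intro z hz
  rw [zero_sub, zero_sub, norm_neg, norm_neg]
  refine le_of_forall_pos_lt_add fun ε hε => ?_
  obtain ⟨_, ⟨x, rfl⟩, hd⟩ := Metric.mem_closure_iff.1 hz ε hε
  simp only at hd
  rw [dist_eq_norm, norm_sub_rev] at hd
  have h1 := norm_sub_norm_le (x - T x) z
  linarith [h x]

/-- `‖v‖ = inf_x ‖x − T x‖` ([BM16, Fact 2.2]). [cite: BauschkeMoursi2016, Fact 2.2] -/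
theorem norm_minDisp_eq_iInf (hT : ∀ x y, ‖T x - T y‖ ≤ ‖x - y‖) :
    ‖minDisp T‖ = ⨅ x : H, ‖x - T x‖ := by
  haveI : Nonempty H := ⟨0⟩
  apply le_antisymm (le_ciInf fun x => norm_minDisp_le_norm_sub hT x)
  refine le_of_forall_pos_lt_add fun ε hε => ?_
  obtain ⟨_, ⟨x, rfl⟩, hd⟩ := Metric.mem_closure_iff.1 (minDisp_mem hT) ε hε
  simp only at hd
  rw [dist_eq_norm, norm_sub_rev] at hd
  have hb : BddBelow (Set.range fun x : H => ‖x - T x‖) :=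
    ⟨0, by rintro _ ⟨x, rfl⟩; exact norm_nonneg _⟩
  have h1 := norm_sub_norm_le (x - T x) (minDisp T)
  calc (⨅ x : H, ‖x - T x‖) ≤ ‖x - T x‖ := ciInf_le hb x
    _ < ‖minDisp T‖ + ε := by linarith

/-- Displacements approximating `v`: for `ε > 0` some `x` has `‖(x − Tx) − v‖ < ε`.
[cite: LiuRyuYin2018, Thm 3] -/
theorem exists_norm_sub_sub_minDisp_lt (hT : ∀ x y, ‖T x - T y‖ ≤ ‖x - y‖) (hε : 0 < ε) :
    ∃ x, ‖(x - T x) - minDisp T‖ < ε := by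
  obtain ⟨_, ⟨x, rfl⟩, hd⟩ := Metric.mem_closure_iff.1 (minDisp_mem hT) ε hε
  exact ⟨x, by rwa [dist_eq_norm, norm_sub_rev] at hd⟩

/-- For `ε > 0` some `x` has `‖x − Tx‖ < ‖v‖ + ε`. [cite: BauschkeMoursi2016, Fact 2.2] -/
theorem exists_norm_sub_lt (hT : ∀ x y, ‖T x - T y‖ ≤ ‖x - y‖) (hε : 0 < ε) :
    ∃ x, ‖x - T x‖ < ‖minDisp T‖ + ε := by
  obtain ⟨x, hx⟩ := exists_norm_sub_sub_minDisp_lt hT hε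
  refine ⟨x, ?_⟩
  have h1 := norm_sub_norm_le (x - T x) (minDisp T)
  linarith

/-- `v = 0 ⟺ inf_x ‖x − Tx‖ = 0`, i.e. `T` has approximate fixed points.
[cite: BauschkeMoursi2016, Fact 2.2] -/
theorem minDisp_eq_zero_iff (hT : ∀ x y, ‖T x - T y‖ ≤ ‖x - y‖) :
    minDisp T = 0 ↔ ∀ ε > 0, ∃ x, ‖x - T x‖ < ε := by
  constructor
  · intro h ε hε
    obtain ⟨x, hx⟩ := exists_norm_sub_lt hT hε
    exact ⟨x, by simpa [h] using hx⟩
  · intro h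
    have h1 : ‖minDisp T‖ ≤ 0 := by
      refine le_of_forall_pos_lt_add fun ε hε => ?_
      obtain ⟨x, hx⟩ := h ε hε
      rw [zero_add]
      exact (norm_minDisp_le_norm_sub hT x).trans_lt hx
    exact norm_le_zero_iff.1 h1

/-- If `T` has a fixed point then `v = 0` ([LRY19, §2.2]: "when `T` has a fixed point then
`v = 0`, but `v = 0` is possible even when `T` has no fixed point"). [cite: LiuRyuYin2018, §2.2] -/
theorem minDisp_eq_zero_of_apply_eq (hT : ∀ x y, ‖T x - T y‖ ≤ ‖x - y‖) (hx : T x = x) :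
    minDisp T = 0 := by
  have h := norm_minDisp_le_norm_sub hT x
  rw [hx, sub_self, norm_zero] at h
  exact norm_le_zero_iff.1 h

/-- If `v ≠ 0` then `T` has no fixed point. [cite: LiuRyuYin2018, §2.2] -/
theorem apply_ne_self_of_minDisp_ne_zero (hT : ∀ x y, ‖T x - T y‖ ≤ ‖x - y‖)
    (hv : minDisp T ≠ 0) (x : H) : T x ≠ x :=
  fun hx => hv (minDisp_eq_zero_of_apply_eq hT hx)

end Hilbert

end Basic

/-! ## Orbits of a nonexpansive map -/

/-- `‖Tⁿx − Tⁿy‖ ≤ ‖x − y‖`. [cite: Pazy1971, Introduction] -/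
theorem norm_iterate_sub_iterate_le (hT : ∀ x y, ‖T x - T y‖ ≤ ‖x - y‖) (x y : H) (n : ℕ) :
    ‖T^[n] x - T^[n] y‖ ≤ ‖x - y‖ := by
  induction n with
  | zero => simp
  | succ n ih =>
    rw [Function.iterate_succ_apply', Function.iterate_succ_apply']
    exact (hT _ _).trans ih

/-- `‖Tⁿx − Tⁿ⁺¹x‖ ≤ ‖x − Tx‖`. [cite: Pazy1971, Introduction] -/
theorem norm_disp_le (hT : ∀ x y, ‖T x - T y‖ ≤ ‖x - y‖) (x : H) (n : ℕ) :
    ‖T^[n] x - T^[n + 1] x‖ ≤ ‖x - T x‖ := by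
  rw [Function.iterate_succ_apply]
  exact norm_iterate_sub_iterate_le hT x (T x) n

/-- The displacements along an orbit are non-increasing in norm:
`‖Tⁿ⁺¹x − Tⁿ⁺²x‖ ≤ ‖Tⁿx − Tⁿ⁺¹x‖`. [cite: LiuRyuYin2018, Thm 3] -/
theorem norm_disp_succ_le (hT : ∀ x y, ‖T x - T y‖ ≤ ‖x - y‖) (x : H) (n : ℕ) :
    ‖T^[n + 1] x - T^[n + 2] x‖ ≤ ‖T^[n] x - T^[n + 1] x‖ := by
  have e1 : T^[n + 2] x = T (T^[n + 1] x) := Function.iterate_succ_apply' T (n + 1) x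
  have e2 : T^[n + 1] x = T (T^[n] x) := Function.iterate_succ_apply' T n x
  rw [e1, e2]
  exact hT _ _

/-- `n ↦ ‖Tⁿx − Tⁿ⁺¹x‖` is antitone. [cite: LiuRyuYin2018, Thm 3] -/
theorem antitone_norm_disp (hT : ∀ x y, ‖T x - T y‖ ≤ ‖x - y‖) (x : H) :
    Antitone fun n => ‖T^[n] x - T^[n + 1] x‖ :=
  antitone_nat_of_succ_le fun n => norm_disp_succ_le hT x n

/-- Telescoping: `x − Tⁿx = Σ_{i<n} (Tⁱx − Tⁱ⁺¹x)`. [folklore] -/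
private theorem sub_iterate_eq_sum (T : H → H) (x : H) (n : ℕ) :
    x - T^[n] x = ∑ i ∈ range n, (T^[i] x - T^[i + 1] x) := by
  induction n with
  | zero => simp
  | succ n ih =>
    rw [sum_range_succ, ← ih]
    abel

/-- `‖x − Tⁿx‖ ≤ n‖x − Tx‖`. [cite: Pazy1971, Introduction] -/
theorem norm_sub_iterate_le (hT : ∀ x y, ‖T x - T y‖ ≤ ‖x - y‖) (x : H) (n : ℕ) :
    ‖x - T^[n] x‖ ≤ n * ‖x - T x‖ := by
  rw [sub_iterate_eq_sum]
  calc ‖∑ i ∈ range n, (T^[i] x - T^[i + 1] x)‖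
      ≤ ∑ i ∈ range n, ‖T^[i] x - T^[i + 1] x‖ := norm_sum_le _ _
    _ ≤ ∑ i ∈ range n, ‖x - T x‖ := sum_le_sum fun i _ => norm_disp_le hT x i
    _ = n * ‖x - T x‖ := by simp

/-- `‖x − Tⁿx‖ ≤ 2‖x − y‖ + n‖y − Ty‖` (compare the orbit of `x` with that of `y`).
[cite: Pazy1971, Introduction] -/
theorem norm_sub_iterate_le' (hT : ∀ x y, ‖T x - T y‖ ≤ ‖x - y‖) (x y : H) (n : ℕ) :
    ‖x - T^[n] x‖ ≤ 2 * ‖x - y‖ + n * ‖y - T y‖ := by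
  have e : x - T^[n] x = (x - y) + (y - T^[n] y) + (T^[n] y - T^[n] x) := by abel
  rw [e]
  calc ‖(x - y) + (y - T^[n] y) + (T^[n] y - T^[n] x)‖
      ≤ ‖x - y‖ + ‖y - T^[n] y‖ + ‖T^[n] y - T^[n] x‖ := norm_add₃_le
    _ ≤ ‖x - y‖ + n * ‖y - T y‖ + ‖y - x‖ :=
        add_le_add (add_le_add le_rfl (norm_sub_iterate_le hT y n))
          (norm_iterate_sub_iterate_le hT y x n)
    _ = 2 * ‖x - y‖ + n * ‖y - T y‖ := by rw [norm_sub_rev y x]; ring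

/-- From `‖u_n − a‖² → 0` to `u_n → a`. [folklore] -/
private theorem tendsto_of_norm_sub_sq {u : ℕ → H} {a : H}
    (h : Tendsto (fun n => ‖u n - a‖ ^ 2) atTop (𝓝 0)) : Tendsto u atTop (𝓝 a) := by
  rw [tendsto_iff_norm_sub_tendsto_zero]
  simpa [Real.sqrt_sq (norm_nonneg _)] using h.sqrt

/-! ## [Paz71]: `(x − Tⁿx)/n → v`, `Tⁿx/n → −v`, `‖Tⁿx‖/n → ‖v‖` -/

section Pazy

variable [InnerProductSpace ℝ H]

/-- `‖(x − Tⁿx)/n‖ ≤ 2‖x − y‖/n + ‖y − Ty‖` (`n ≥ 1`). [cite: Pazy1971, Introduction] -/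
theorem norm_avg_le (hT : ∀ x y, ‖T x - T y‖ ≤ ‖x - y‖) (x y : H) (hn : n ≠ 0) :
    ‖(n : ℝ)⁻¹ • (x - T^[n] x)‖ ≤ 2 * ‖x - y‖ / n + ‖y - T y‖ := by
  have hn' : (0 : ℝ) < n := by positivity
  rw [norm_smul, norm_inv, Real.norm_natCast]
  calc (n : ℝ)⁻¹ * ‖x - T^[n] x‖ ≤ (n : ℝ)⁻¹ * (2 * ‖x - y‖ + n * ‖y - T y‖) :=
        mul_le_mul_of_nonneg_left (norm_sub_iterate_le' hT x y n) (by positivity)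
    _ = 2 * ‖x - y‖ / n + ‖y - T y‖ := by
        rw [mul_add, inv_mul_cancel_left₀ hn'.ne', ← div_eq_inv_mul]

variable [CompleteSpace H]

/-- `(x − Tⁿx)/n`, the average of the first `n` displacements of the orbit, lies in the convex set
`cl ran(I − T)` (`n ≥ 1`). [cite: Pazy1971, Introduction] -/
theorem avg_mem_closure_dispRange (hT : ∀ x y, ‖T x - T y‖ ≤ ‖x - y‖) (x : H) (hn : n ≠ 0) :
    (n : ℝ)⁻¹ • (x - T^[n] x) ∈ closure (dispRange T) := by
  rw [sub_iterate_eq_sum, smul_sum]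
  refine (convex_closure_dispRange hT).sum_mem (fun i _ => by positivity) ?_
    fun i _ => subset_closure (iterate_sub_iterate_succ_mem_dispRange T x i)
  rw [sum_const, card_range, nsmul_eq_mul, mul_inv_cancel₀ (Nat.cast_ne_zero.2 hn)]

/-- `‖v‖ ≤ ‖(x − Tⁿx)/n‖` (`n ≥ 1`). [cite: Pazy1971, Introduction] -/
theorem norm_minDisp_le_norm_avg (hT : ∀ x y, ‖T x - T y‖ ≤ ‖x - y‖) (x : H) (hn : n ≠ 0) :
    ‖minDisp T‖ ≤ ‖(n : ℝ)⁻¹ • (x - T^[n] x)‖ :=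
  norm_minDisp_le hT (avg_mem_closure_dispRange hT x hn)

/-- **[Paz71]: `‖(x − Tⁿx)/n‖ → ‖v‖ = inf_y ‖y − Ty‖`.** [cite: Pazy1971, Introduction] -/
theorem tendsto_norm_avg (hT : ∀ x y, ‖T x - T y‖ ≤ ‖x - y‖) (x : H) :
    Tendsto (fun n : ℕ => ‖(n : ℝ)⁻¹ • (x - T^[n] x)‖) atTop (𝓝 ‖minDisp T‖) := by
  rw [Metric.tendsto_atTop]
  intro ε hε
  obtain ⟨y, hy⟩ := exists_norm_sub_lt hT (half_pos hε)
  obtain ⟨N, hN⟩ := exists_nat_gt (2 * ‖x - y‖ / (ε / 2))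
  refine ⟨N + 1, fun n hn => ?_⟩
  have hn0 : n ≠ 0 := by omega
  have hnpos : (0 : ℝ) < n := by positivity
  rw [Real.dist_eq, abs_lt]
  constructor
  · linarith [norm_minDisp_le_norm_avg hT x hn0]
  · have h1 := norm_avg_le hT x y hn0
    have h2 : 2 * ‖x - y‖ / n < ε / 2 := by
      rw [div_lt_iff₀ hnpos]
      have hNn : (N : ℝ) + 1 ≤ n := by exact_mod_cast hn
      have h3 : 2 * ‖x - y‖ < N * (ε / 2) := (div_lt_iff₀ (half_pos hε)).1 hN
      calc 2 * ‖x - y‖ < N * (ε / 2) := h3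
        _ ≤ n * (ε / 2) := by gcongr; linarith
        _ = ε / 2 * n := by ring
    linarith

/-- **[Paz71]: `(x − Tⁿx)/n → v`** (from `‖aₙ‖ → ‖v‖` and `‖aₙ − v‖² ≤ ‖aₙ‖² − ‖v‖²` on the
convex set `cl ran(I − T)`). [cite: Pazy1971, Introduction] -/
theorem tendsto_avg (hT : ∀ x y, ‖T x - T y‖ ≤ ‖x - y‖) (x : H) :
    Tendsto (fun n : ℕ => (n : ℝ)⁻¹ • (x - T^[n] x)) atTop (𝓝 (minDisp T)) := by
  have h1 : Tendsto (fun n : ℕ => ‖(n : ℝ)⁻¹ • (x - T^[n] x)‖ ^ 2 - ‖minDisp T‖ ^ 2)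
      atTop (𝓝 0) := by
    have h := ((tendsto_norm_avg hT x).pow 2).sub_const (‖minDisp T‖ ^ 2)
    rwa [sub_self] at h
  have h2 : Tendsto (fun n : ℕ => ‖(n : ℝ)⁻¹ • (x - T^[n] x) - minDisp T‖ ^ 2) atTop (𝓝 0) := by
    refine squeeze_zero' (Eventually.of_forall fun n => sq_nonneg _) ?_ h1
    filter_upwards [eventually_ne_atTop 0] with n hn
    exact norm_sub_minDisp_sq_le hT (avg_mem_closure_dispRange hT x hn)
  exact tendsto_of_norm_sub_sq h2

/-- **[Paz71]: `Tⁿx/n → −v`** ([BHM14]/[BM16]: "`v = −lim Tⁿx/n`").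
[cite: Pazy1971, Introduction] -/
theorem tendsto_inv_smul_iterate (hT : ∀ x y, ‖T x - T y‖ ≤ ‖x - y‖) (x : H) :
    Tendsto (fun n : ℕ => (n : ℝ)⁻¹ • T^[n] x) atTop (𝓝 (-minDisp T)) := by
  have h0 : Tendsto (fun n : ℕ => (n : ℝ)⁻¹ • x) atTop (𝓝 0) := by
    have h0' : Tendsto (fun n : ℕ => ((n : ℝ))⁻¹) atTop (𝓝 0) :=
      tendsto_inv_atTop_zero.comp tendsto_natCast_atTop_atTop
    simpa using h0'.smul_const x
  have h := h0.sub (tendsto_avg hT x)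
  rw [zero_sub] at h
  refine (tendsto_congr fun n => ?_).1 h
  rw [smul_sub]
  abel

/-- **[Paz71]: `‖Tⁿx‖/n → ‖v‖ = inf_y ‖y − Ty‖`.** [cite: Pazy1971, Introduction] -/
theorem tendsto_norm_iterate_div (hT : ∀ x y, ‖T x - T y‖ ≤ ‖x - y‖) (x : H) :
    Tendsto (fun n : ℕ => ‖T^[n] x‖ / n) atTop (𝓝 ‖minDisp T‖) := by
  have h := (tendsto_inv_smul_iterate hT x).norm
  rw [norm_neg] at h
  refine (tendsto_congr fun n => ?_).1 h
  rw [norm_smul, norm_inv, Real.norm_natCast, div_eq_inv_mul]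

/-- **[Paz71] (as used in [BM16, proof of Thm 4.2]): if `v ≠ 0` then `‖Tⁿx‖ → ∞` for every
`x`.** [cite: Pazy1971, Introduction] -/
theorem tendsto_norm_iterate_atTop (hT : ∀ x y, ‖T x - T y‖ ≤ ‖x - y‖) (hv : minDisp T ≠ 0)
    (x : H) : Tendsto (fun n : ℕ => ‖T^[n] x‖) atTop atTop := by
  have hd : 0 < ‖minDisp T‖ := norm_pos_iff.2 hv
  have h1 : ∀ᶠ n : ℕ in atTop, ‖minDisp T‖ / 2 * n ≤ ‖T^[n] x‖ := by
    filter_upwards [(tendsto_order.1 (tendsto_norm_iterate_div hT x)).1 _ (half_lt_self hd),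
      eventually_gt_atTop 0] with n hn hn0
    have hnpos : (0 : ℝ) < n := by exact_mod_cast hn0
    rw [lt_div_iff₀ hnpos] at hn
    linarith
  exact tendsto_atTop_mono' atTop h1
    (tendsto_natCast_atTop_atTop.const_mul_atTop (half_pos hd))

end Pazy

/-! ## [BBR78, Cor 2.3] / [LRY19, Thm 3]: `Tⁿx − Tⁿ⁺¹x → v` for averaged maps -/

/-- A map satisfying the `ν`-inequality `‖T x − T y‖² + ν‖(x − Tx) − (y − Ty)‖² ≤ ‖x − y‖²`
with `ν ≥ 0` is nonexpansive. [cite: LiuRyuYin2018, Thm 3] -/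
theorem nonexpansive_of_sq (hν : 0 ≤ ν)
    (hS : ∀ x y, ‖T x - T y‖ ^ 2 + ν * ‖(x - T x) - (y - T y)‖ ^ 2 ≤ ‖x - y‖ ^ 2) (x y : H) :
    ‖T x - T y‖ ≤ ‖x - y‖ := by
  have h1 := hS x y
  have h2 : 0 ≤ ν * ‖(x - T x) - (y - T y)‖ ^ 2 := by positivity
  exact (pow_le_pow_iff_left₀ (norm_nonneg _) (norm_nonneg _) two_ne_zero).1 (by linarith)

/-- The summed `ν`-inequality along two orbits ([LRY19, proof of Thm 3], "summing this
inequality"): `ν Σ_{j<k} ‖(Tʲx − Tʲ⁺¹x) − (Tʲy − Tʲ⁺¹y)‖² ≤ ‖x − y‖² − ‖Tᵏx − Tᵏy‖²`.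
[cite: LiuRyuYin2018, Thm 3] -/
theorem mul_sum_norm_disp_sub_disp_sq_le
    (hS : ∀ x y, ‖T x - T y‖ ^ 2 + ν * ‖(x - T x) - (y - T y)‖ ^ 2 ≤ ‖x - y‖ ^ 2) (x y : H)
    (k : ℕ) :
    ν * ∑ j ∈ range k, ‖(T^[j] x - T^[j + 1] x) - (T^[j] y - T^[j + 1] y)‖ ^ 2
      ≤ ‖x - y‖ ^ 2 - ‖T^[k] x - T^[k] y‖ ^ 2 := by
  induction k with
  | zero => simp
  | succ k ih =>
    rw [sum_range_succ, mul_add]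
    have h := hS (T^[k] x) (T^[k] y)
    rw [← Function.iterate_succ_apply' T k x, ← Function.iterate_succ_apply' T k y] at h
    linarith

/-- The displacements of two orbits merge: `(Tʲx − Tʲ⁺¹x) − (Tʲy − Tʲ⁺¹y) → 0` (`ν > 0`).
[cite: LiuRyuYin2018, Thm 3] -/
theorem tendsto_disp_sub_disp (hν : 0 < ν)
    (hS : ∀ x y, ‖T x - T y‖ ^ 2 + ν * ‖(x - T x) - (y - T y)‖ ^ 2 ≤ ‖x - y‖ ^ 2) (x y : H) :
    Tendsto (fun j : ℕ => (T^[j] x - T^[j + 1] x) - (T^[j] y - T^[j + 1] y)) atTop (𝓝 0) := by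
  have hsum : Summable fun j : ℕ => ‖(T^[j] x - T^[j + 1] x) - (T^[j] y - T^[j + 1] y)‖ ^ 2 := by
    refine summable_of_sum_range_le (c := ‖x - y‖ ^ 2 / ν) (fun j => sq_nonneg _) fun k => ?_
    rw [le_div_iff₀ hν, mul_comm]
    linarith [mul_sum_norm_disp_sub_disp_sq_le hS x y k, sq_nonneg ‖T^[k] x - T^[k] y‖]
  apply tendsto_of_norm_sub_sq
  simpa using hsum.tendsto_atTop_zero

section BBR

variable [InnerProductSpace ℝ H] [CompleteSpace H]

/-- The key step of [LRY19, proof of Thm 3] (their (eq:sequence)): if `‖y − Ty‖` is close to `‖v‖`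
then EVERY displacement of the orbit of `y` is close to `v`; quantitatively, for `ε > 0` there is
`y` with `‖(Tⁿy − Tⁿ⁺¹y) − v‖ ≤ ε` for all `n`. [cite: LiuRyuYin2018, Thm 3] -/
theorem exists_forall_norm_disp_sub_minDisp_le (hT : ∀ x y, ‖T x - T y‖ ≤ ‖x - y‖)
    (hε : 0 < ε) : ∃ y : H, ∀ n : ℕ, ‖(T^[n] y - T^[n + 1] y) - minDisp T‖ ≤ ε := by
  set d := ‖minDisp T‖ with hd
  have hd0 : 0 ≤ d := norm_nonneg _
  set η := min 1 (ε ^ 2 / (2 * d + 1)) with hηdef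
  have hη0 : 0 < η := lt_min one_pos (by positivity)
  have hη1 : η ≤ 1 := min_le_left _ _
  have hη2 : η * (2 * d + 1) ≤ ε ^ 2 := by
    rw [← le_div_iff₀ (by positivity)]
    exact min_le_right _ _
  obtain ⟨y, hy⟩ := exists_norm_sub_lt hT hη0
  refine ⟨y, fun n => ?_⟩
  have hmem : T^[n] y - T^[n + 1] y ∈ closure (dispRange T) :=
    subset_closure (iterate_sub_iterate_succ_mem_dispRange T y n)
  have h1 := norm_sub_minDisp_sq_le hT hmem
  have h2 : ‖T^[n] y - T^[n + 1] y‖ ≤ d + η := (norm_disp_le hT y n).trans hy.le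
  have h3 : ‖T^[n] y - T^[n + 1] y‖ ^ 2 ≤ (d + η) ^ 2 := pow_le_pow_left₀ (norm_nonneg _) h2 2
  have h4 : ‖(T^[n] y - T^[n + 1] y) - minDisp T‖ ^ 2 ≤ ε ^ 2 := by
    have h5 : (d + η) ^ 2 - d ^ 2 = η * (2 * d + η) := by ring
    have h6 : η * (2 * d + η) ≤ η * (2 * d + 1) := by gcongr
    linarith
  exact (pow_le_pow_iff_left₀ (norm_nonneg _) hε.le two_ne_zero).1 h4

/-- **[BBR78, Corollary 2.3] (statement of [LRY19, Lemma 1] / [Ban21, Fact 2.1]; proof of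
[LRY19, Thm 3]): for a map satisfying the `ν`-inequality with `ν > 0` (an averaged map), the
displacements of every orbit converge to the minimal displacement vector,
`Tⁿx − Tⁿ⁺¹x → v = P_{cl ran(I−T)}(0)`.** [cite: BaillonBruckReich1978, Cor 2.3] -/
theorem tendsto_disp_of_sq (hν : 0 < ν)
    (hS : ∀ x y, ‖T x - T y‖ ^ 2 + ν * ‖(x - T x) - (y - T y)‖ ^ 2 ≤ ‖x - y‖ ^ 2) (x : H) :
    Tendsto (fun n : ℕ => T^[n] x - T^[n + 1] x) atTop (𝓝 (minDisp T)) := by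
  have hT := nonexpansive_of_sq hν.le hS
  rw [Metric.tendsto_atTop]
  intro ε hε
  obtain ⟨y, hy⟩ := exists_forall_norm_disp_sub_minDisp_le hT (half_pos hε)
  obtain ⟨N, hN⟩ := Metric.tendsto_atTop.1 (tendsto_disp_sub_disp hν hS x y) (ε / 2) (half_pos hε)
  refine ⟨N, fun n hn => ?_⟩
  have h1 := hN n hn
  rw [dist_zero_right] at h1
  rw [dist_eq_norm]
  calc ‖(T^[n] x - T^[n + 1] x) - minDisp T‖
      = ‖((T^[n] x - T^[n + 1] x) - (T^[n] y - T^[n + 1] y)) +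
          ((T^[n] y - T^[n + 1] y) - minDisp T)‖ := by congr 1; abel
    _ ≤ ‖(T^[n] x - T^[n + 1] x) - (T^[n] y - T^[n + 1] y)‖ +
          ‖(T^[n] y - T^[n + 1] y) - minDisp T‖ := norm_add_le _ _
    _ < ε / 2 + ε / 2 := add_lt_add_of_lt_of_le h1 (hy n)
    _ = ε := by ring

/-- `‖Tⁿx − Tⁿ⁺¹x‖ → ‖v‖` (and the sequence is non-increasing, `antitone_norm_disp`, and bounded
below by `‖v‖`, `norm_minDisp_le_norm_disp`). [cite: LiuRyuYin2018, Thm 3] -/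
theorem tendsto_norm_disp_of_sq (hν : 0 < ν)
    (hS : ∀ x y, ‖T x - T y‖ ^ 2 + ν * ‖(x - T x) - (y - T y)‖ ^ 2 ≤ ‖x - y‖ ^ 2) (x : H) :
    Tendsto (fun n : ℕ => ‖T^[n] x - T^[n + 1] x‖) atTop (𝓝 ‖minDisp T‖) :=
  (tendsto_disp_of_sq hν hS x).norm

/-- **[LRY19, Theorem 3]**, the approximate rate: for every `ε > 0` there is `M ≥ 0` (depending
on `T`, `x`, `ε`) such that for all `k` some `j ≤ k` has `‖(Tʲx − Tʲ⁺¹x) − v‖ ≤ M/√(k+1) + ε`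
(so `‖v‖ ≤ min_{j≤k} ‖Tʲx − Tʲ⁺¹x‖ ≤ ‖v‖ + M/√(k+1) + ε`). [cite: LiuRyuYin2018, Thm 3] -/
theorem exists_norm_disp_sub_minDisp_le (hν : 0 < ν)
    (hS : ∀ x y, ‖T x - T y‖ ^ 2 + ν * ‖(x - T x) - (y - T y)‖ ^ 2 ≤ ‖x - y‖ ^ 2) (x : H)
    (hε : 0 < ε) :
    ∃ M : ℝ, 0 ≤ M ∧ ∀ k : ℕ, ∃ j ≤ k,
      ‖(T^[j] x - T^[j + 1] x) - minDisp T‖ ≤ M / √((k : ℝ) + 1) + ε := by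
  have hT := nonexpansive_of_sq hν.le hS
  obtain ⟨y, hy⟩ := exists_forall_norm_disp_sub_minDisp_le hT hε
  refine ⟨‖x - y‖ / √ν, by positivity, fun k => ?_⟩
  have hk : (0 : ℝ) < (k : ℝ) + 1 := by positivity
  -- some `j ≤ k` has `ν ‖d_j x − d_j y‖² ≤ ‖x − y‖²/(k+1)` (minimum ≤ average)
  have hsum : ∑ j ∈ range (k + 1), ν * ‖(T^[j] x - T^[j + 1] x) - (T^[j] y - T^[j + 1] y)‖ ^ 2
      ≤ ∑ _j ∈ range (k + 1), ‖x - y‖ ^ 2 / ((k : ℝ) + 1) := by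
    rw [← mul_sum, sum_const, card_range, nsmul_eq_mul, Nat.cast_add_one, mul_div_cancel₀ _ hk.ne']
    linarith [mul_sum_norm_disp_sub_disp_sq_le hS x y (k + 1),
      sq_nonneg ‖T^[k + 1] x - T^[k + 1] y‖]
  obtain ⟨j, hj, hjle⟩ := exists_le_of_sum_le (nonempty_range_iff.2 (Nat.succ_ne_zero k)) hsum
  refine ⟨j, Nat.lt_succ_iff.1 (mem_range.1 hj), ?_⟩
  have h1 : ‖(T^[j] x - T^[j + 1] x) - (T^[j] y - T^[j + 1] y)‖ ≤ ‖x - y‖ / √ν / √((k : ℝ) + 1) := by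
    have h2 : ‖(T^[j] x - T^[j + 1] x) - (T^[j] y - T^[j + 1] y)‖ ^ 2
        ≤ (‖x - y‖ / √ν / √((k : ℝ) + 1)) ^ 2 := by
      rw [div_pow, div_pow, Real.sq_sqrt hν.le, Real.sq_sqrt hk.le, div_div, le_div_iff₀ (by positivity)]
      calc ‖(T^[j] x - T^[j + 1] x) - (T^[j] y - T^[j + 1] y)‖ ^ 2 * (ν * ((k : ℝ) + 1))
          = ν * ‖(T^[j] x - T^[j + 1] x) - (T^[j] y - T^[j + 1] y)‖ ^ 2 * ((k : ℝ) + 1) := by ring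
        _ ≤ ‖x - y‖ ^ 2 / ((k : ℝ) + 1) * ((k : ℝ) + 1) := mul_le_mul_of_nonneg_right hjle hk.le
        _ = ‖x - y‖ ^ 2 := div_mul_cancel₀ _ hk.ne'
    exact (pow_le_pow_iff_left₀ (norm_nonneg _) (by positivity) two_ne_zero).1 h2
  calc ‖(T^[j] x - T^[j + 1] x) - minDisp T‖
      = ‖((T^[j] x - T^[j + 1] x) - (T^[j] y - T^[j + 1] y)) +
          ((T^[j] y - T^[j + 1] y) - minDisp T)‖ := by congr 1; abel
    _ ≤ ‖(T^[j] x - T^[j + 1] x) - (T^[j] y - T^[j + 1] y)‖ +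
          ‖(T^[j] y - T^[j + 1] y) - minDisp T‖ := norm_add_le _ _
    _ ≤ ‖x - y‖ / √ν / √((k : ℝ) + 1) + ε := add_le_add h1 (hy j)

/-- **[LRY19, Lemma 1 and Theorem 3]: for a firmly nonexpansive `T`
(`‖Tx − Ty‖² + ‖(I−T)x − (I−T)y‖² ≤ ‖x − y‖²`), `zᵏ − zᵏ⁺¹ → v` along `zᵏ⁺¹ = T zᵏ`.**
[cite: LiuRyuYin2018, Lemma 1] -/
theorem tendsto_disp_of_firmlyNonexpansive
    (hF : ∀ x y, ‖T x - T y‖ ^ 2 + ‖(x - T x) - (y - T y)‖ ^ 2 ≤ ‖x - y‖ ^ 2) (x : H) :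
    Tendsto (fun n : ℕ => T^[n] x - T^[n + 1] x) atTop (𝓝 (minDisp T)) :=
  tendsto_disp_of_sq one_pos (fun x y => by simpa only [one_mul] using hF x y) x

/-- **[BBR78, Cor 2.3] / [Ban21, Fact 2.1] for `α`-averaged maps** (the tree's `IsAveraged α T`,
`0 < α < 1`): `Tⁿx − Tⁿ⁺¹x → v`. [cite: Banjac2021, Fact 2.1] -/
theorem tendsto_disp_of_isAveraged {α : ℝ} (h : IsAveraged α T) (hα0 : 0 < α) (hα1 : α < 1)
    (x : H) : Tendsto (fun n : ℕ => T^[n] x - T^[n + 1] x) atTop (𝓝 (minDisp T)) :=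
  tendsto_disp_of_sq (div_pos (by linarith) hα0) (fun x y => IsAveraged.norm_sq_add_le h hα0 x y) x

end BBR

/-! ## Dictionary: the Krasnosel'skiĭ–Mann and Douglas–Rachford iterations of the tree -/

section KM

variable [InnerProductSpace ℝ H] {R : H → H} {t : ℝ}

/-- `x − U_λ x = λ(x − R x)` for the averaged map `U_λ = (1 − λ)I + λR`.
[cite: Banjac2021, Fact 2.1] -/
theorem sub_averagedMap (R : H → H) (t : ℝ) (x : H) :
    x - averagedMap R t x = t • (x - R x) := by
  rw [← neg_sub, averagedMap_sub_self, ← smul_neg, neg_sub]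

variable [CompleteSpace H]

/-- The minimal displacement vector of the averaged map `U_λ = (1 − λ)I + λR` (`0 ≤ λ ≤ 1`) of a
nonexpansive `R` is `λ v_R`. [cite: Banjac2021, Fact 2.1] -/
theorem minDisp_averagedMap (hR : ∀ x y, ‖R x - R y‖ ≤ ‖x - y‖) (ht0 : 0 ≤ t) (ht1 : t ≤ 1) :
    minDisp (averagedMap R t) = t • minDisp R := by
  have hT : ∀ x y, ‖averagedMap R t x - averagedMap R t y‖ ≤ ‖x - y‖ :=
    norm_averagedMap_sub_averagedMap_le hR ht0 ht1
  symm
  apply eq_minDisp hT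
  · rw [Metric.mem_closure_iff]
    intro δ hδ
    rcases ht0.eq_or_lt with h0 | htpos
    · refine ⟨0 - averagedMap R t 0, sub_mem_dispRange _ 0, ?_⟩
      rw [sub_averagedMap, ← h0, zero_smul, zero_smul, dist_self]
      exact hδ
    · obtain ⟨x, hx⟩ := exists_norm_sub_sub_minDisp_lt hR (div_pos hδ htpos)
      refine ⟨x - averagedMap R t x, sub_mem_dispRange _ x, ?_⟩
      rw [dist_eq_norm, sub_averagedMap, ← smul_sub, norm_smul, Real.norm_eq_abs,
        abs_of_pos htpos, norm_sub_rev]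
      calc t * ‖(x - R x) - minDisp R‖ < t * (δ / t) := mul_lt_mul_of_pos_left hx htpos
        _ = δ := mul_div_cancel₀ _ htpos.ne'
  · intro x
    rw [sub_averagedMap, norm_smul, norm_smul, Real.norm_eq_abs, abs_of_nonneg ht0]
    exact mul_le_mul_of_nonneg_left (norm_minDisp_le_norm_sub hR x) ht0

/-- **[BBR78, Cor 2.3] / [Ban21, Fact 2.1] for the Krasnosel'skiĭ–Mann iteration**
`x_{n+1} = (1 − λ)x_n + λ R x_n` of a nonexpansive `R` with constant `λ ∈ ]0,1[`:
`x_n − x_{n+1} → λ v_R`. [cite: Banjac2021, Fact 2.1] -/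
theorem tendsto_kmIter_sub_kmIter_succ (hR : ∀ x y, ‖R x - R y‖ ≤ ‖x - y‖) (ht0 : 0 < t)
    (ht1 : t < 1) (x : H) :
    Tendsto (fun n => kmIter R t x n - kmIter R t x (n + 1)) atTop (𝓝 (t • minDisp R)) := by
  rw [← minDisp_averagedMap hR ht0.le ht1.le]
  exact tendsto_disp_of_isAveraged (isAveraged_averagedMap hR t) ht0 ht1 x

/-- `‖x_n − x_{n+1}‖ → λ‖v_R‖` for the Krasnosel'skiĭ–Mann iteration (`λ ∈ ]0,1[`).
[cite: Banjac2021, Fact 2.1] -/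
theorem tendsto_norm_kmIter_sub_kmIter_succ (hR : ∀ x y, ‖R x - R y‖ ≤ ‖x - y‖) (ht0 : 0 < t)
    (ht1 : t < 1) (x : H) :
    Tendsto (fun n => ‖kmIter R t x n - kmIter R t x (n + 1)‖) atTop (𝓝 (t * ‖minDisp R‖)) := by
  have h := (tendsto_kmIter_sub_kmIter_succ hR ht0 ht1 x).norm
  rwa [norm_smul, Real.norm_eq_abs, abs_of_pos ht0] at h

/-- **[Paz71] for the Krasnosel'skiĭ–Mann iteration** (`λ ∈ [0,1]`): `(x₀ − x_n)/n → λ v_R`.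
[cite: Pazy1971, Introduction] -/
theorem tendsto_avg_kmIter (hR : ∀ x y, ‖R x - R y‖ ≤ ‖x - y‖) (ht0 : 0 ≤ t) (ht1 : t ≤ 1)
    (x : H) :
    Tendsto (fun n : ℕ => (n : ℝ)⁻¹ • (x - kmIter R t x n)) atTop (𝓝 (t • minDisp R)) := by
  rw [← minDisp_averagedMap hR ht0 ht1]
  exact tendsto_avg (norm_averagedMap_sub_averagedMap_le hR ht0 ht1) x

/-- **[Paz71] for the Krasnosel'skiĭ–Mann iteration** (`λ ∈ ]0,1]`): if `v_R ≠ 0` then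
`‖x_n‖ → ∞`. [cite: Pazy1971, Introduction] -/
theorem tendsto_norm_kmIter_atTop (hR : ∀ x y, ‖R x - R y‖ ≤ ‖x - y‖) (ht0 : 0 < t)
    (ht1 : t ≤ 1) (hv : minDisp R ≠ 0) (x : H) :
    Tendsto (fun n => ‖kmIter R t x n‖) atTop atTop := by
  have hv' : minDisp (averagedMap R t) ≠ 0 := by
    rw [minDisp_averagedMap hR ht0.le ht1]
    exact smul_ne_zero ht0.ne' hv
  exact tendsto_norm_iterate_atTop (norm_averagedMap_sub_averagedMap_le hR ht0.le ht1) hv' x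

end KM

section DR

variable [InnerProductSpace ℝ H] [CompleteSpace H] {γ : ℝ} {A B : Set (H × H)} {ja jb : H → H}

/-- **[LRY19, Lemma 1 / Thm 3] for the Douglas–Rachford iteration** `zᵏ⁺¹ = G(zᵏ)`,
`G = J_{γA}(2J_{γB} − I) + (I − J_{γB})` the (firmly nonexpansive, `½`-averaged) DR operator of two
monotone operators given by resolvent maps: `zᵏ − zᵏ⁺¹ → v_G = P_{cl ran(I − G)}(0)`.
[cite: LiuRyuYin2018, Lemma 1] -/
theorem tendsto_drIter_sub_drIter_succ (hja : IsResolventMap γ A ja) (hjb : IsResolventMap γ B jb)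
    (hA : IsMonotone A) (hB : IsMonotone B) (hγ : 0 < γ) (z : H) :
    Tendsto (fun n => drIter ja jb z n - drIter ja jb z (n + 1)) atTop
      (𝓝 (minDisp (drStep ja jb))) := by
  have hR := norm_reflComp_sub_le hja hjb hA hB hγ
  have hav : IsAveraged (1 / 2) (drStep ja jb) := by
    rw [drStep_eq_averagedMap]
    exact isAveraged_averagedMap hR _
  exact tendsto_disp_of_isAveraged hav (by norm_num) (by norm_num) z

/-- For the Douglas–Rachford iteration: `v_G = ½ v_{R_A R_B}` (the DR operator is the `½`-averaged
map of the reflection composition). [cite: LiuRyuYin2018, Lemma 1] -/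
theorem minDisp_drStep (hja : IsResolventMap γ A ja) (hjb : IsResolventMap γ B jb)
    (hA : IsMonotone A) (hB : IsMonotone B) (hγ : 0 < γ) :
    minDisp (drStep ja jb) = (1 / 2 : ℝ) • minDisp (reflComp ja jb) := by
  rw [drStep_eq_averagedMap]
  exact minDisp_averagedMap (norm_reflComp_sub_le hja hjb hA hB hγ) (by norm_num) (by norm_num)

/-- For the Douglas–Rachford iteration: if `v_G ≠ 0` (no fixed point, e.g. an infeasible or
pathological problem) then `‖zᵏ‖ → ∞` ([LRY19, §2.2]: "the fixed-point iteration diverges in that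
`‖zᵏ‖ → ∞`. Precisely in what manner `zᵏ` diverges is characterized by the infimal displacement
vector"). [cite: LiuRyuYin2018, §2.2] -/
theorem tendsto_norm_drIter_atTop (hja : IsResolventMap γ A ja) (hjb : IsResolventMap γ B jb)
    (hA : IsMonotone A) (hB : IsMonotone B) (hγ : 0 < γ) (hv : minDisp (drStep ja jb) ≠ 0)
    (z : H) : Tendsto (fun n => ‖drIter ja jb z n‖) atTop atTop :=
  tendsto_norm_iterate_atTop (fun x y => norm_drStep_sub_le hja hjb hA hB hγ y x) hv z

end DR

end Literature.Analysis.Convex.MinimalDisplacement
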